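import Summits.BirchSwinnertonDyer.Rank1Residual.Partition.EisensteinKernelCertificate
import Summits.BirchSwinnertonDyer.Rank1Residual.Additive.GordRamifiedOrdinaryLine
import Summits.BirchSwinnertonDyer.Rank1Residual.X2.ResidualDevissageLine
import Summits.BirchSwinnertonDyer.Rank1Residual.GaloisImage.RamifiedOrdinaryLineTwist
import HarnessLib

/-!
# X3 on the semistable-twist locus at `p = 3`: a PER-PAIR KERNEL CERTIFICATE `(x₀, D, s, q)` for the
# line datum `Φ₀` of the `p = 3` end state (rational `3`-line, EVEN, non-trivial `Γ_ℚ`-action,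
# `χ_{−3}`-twist ramified at `3`) — cell `bsd-addord`, seat `bsd-addord-twist` (strategy = twist
# transport); makes the `p = 3` rows of `X3BranchGordEndStateThree*.lean` certificate-checkable per
# pair like X2a's `CellAGVParCertificates`

HONEST FRAMING (cell `bsd-addord`, `run/shared/lean/pub/bsd-addord/README.md` §4): the programme's
target of record is the full Birch–Swinnerton-Dyer formula for every `E/ℚ` of analytic rank `≤ 1`;
this file is a TOOL: theorems only (no `def`, no named fact, no `sorry`); nothing is booked. No
reduction hypothesis and no named fact enter.

## What

`exists_lineDatum_three_of_cert` — for `W/ℚ` elliptic and a certificate `Ψ₃(x₀) = 0`, `D` squarefree,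
`s ≠ 0`, `D·s² = Ψ₂Sq(x₀)` (the tree's `KernelDisc.exists_isRationalLine_kernelChar_of_cert`: the
rational `3`-line `Φ₀ = ⟨(x₀, ±y₀)⟩` with kernel character `χ_D`) such that `0 < D` (EVEN,
`KernelDisc.lineEven_of_pos`), `q ∣ D` for some ODD prime `q` (non-trivial action: the Kummer element
at `q`, `exists_mem_inertia_smul_geomSqrt_eq_neg`) and `3 ∤ D` (so every inertia group above `3`
fixes `Φ₀` — `smul_geomSqrt_eq_of_mem_inertia` — while some inertia element negates `√−3`,
`exists_mem_absInertia_smul_geomSqrt_pStar_eq_neg`: the `χ_K`-TWIST of `Φ₀` is RAMIFIED at `3` for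
every quadratic `K ∋ θ`, `θ² = −3`): `∃ Φ₀` with exactly the four line hypotheses of
`ClassX3Gord.missingLowerBoundAt_three_rankZero_of_facts[_of_lifting]_of_nonAnomalous`.

References: [GreenbergVatsal2000] §2 p. 28 (the line `Φ` and its character); [SilvermanAEC2009]
Ex. 3.7 (`Ψ₃`); [Lang1983] Ch. 6 Prop. 1.3 (Kummer character on inertia).
-/

set_option autoImplicit false

noncomputable section

open scoped Classical NumberField

namespace Summit.BirchSwinnertonDyer.Rank1Residual.Additive

open WeierstrassCurve Polynomial NumberField IsDedekindDomain Field
  Literature.NumberTheory.GaloisRepresentations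
  Literature.NumberTheory.EllipticCurves
  Literature.NumberTheory.EllipticCurves.Rank1Residual
  Summit.BirchSwinnertonDyer.Rank1Residual.GaloisImage.RamifiedOrdinaryLineTwist

variable {W : WeierstrassCurve ℚ} [W.IsElliptic]

/-- **Per-pair certificate of the `p = 3` line datum.** `Ψ₃(x₀) = 0`, `D` squarefree, `s ≠ 0`,
`D·s² = Ψ₂Sq(x₀)`, `0 < D`, an odd prime `q ∣ D`, and `3 ∤ D` give a rational `3`-line `Φ₀ ≤ W[3]`
which is EVEN, carries a NON-TRIVIAL `Γ_ℚ`-action, and whose `χ_K`-twist is RAMIFIED at `3` for every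
quadratic `K` with `θ² = −3` — the four line hypotheses of the `p = 3` end-state theorems of
`X3BranchGordEndStateThreeOfFacts.lean`. [folklore] -/
theorem exists_lineDatum_three_of_cert [hp : Fact (Nat.Prime 3)] {x₀ s : ℚ} {D : ℤ}
    (hψ : W.Ψ₃.eval x₀ = 0) (hsq : Squarefree D) (hs : s ≠ 0)
    (hDs : (D : ℚ) * s ^ 2 = W.Ψ₂Sq.eval x₀) (hpos : 0 < D)
    (q : ℕ) [hq : Fact q.Prime] (hq2 : q ≠ 2) (hqD : (q : ℤ) ∣ D) (h3D : ¬ (3 : ℤ) ∣ D) :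
    ∃ Φ₀ : AddSubgroup (geomTorsion W ((3 : ℕ) : ℤ)), IsRationalLine W 3 Φ₀ ∧ LineEven W 3 Φ₀ ∧
      (∃ (σ : absoluteGaloisGroup ℚ) (P : W.geomTorsion ((3 : ℕ) : ℤ)), P ∈ Φ₀ ∧ σ • P ≠ P) ∧
      ∀ (K : Type) [Field K] [NumberField K] [(galRange (K := ℚ) K).Normal],
        Module.finrank ℚ K = 2 →
        (∃ θ : K, θ ^ 2 = algebraMap ℚ K ((-1) ^ ((3 : ℕ) / 2) * (3 : ℕ))) →
        ¬ ∀ v : HeightOneSpectrum (𝓞 ℚ), (((3 : ℕ) : ℕ) : 𝓞 ℚ) ∈ v.asIdeal →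
          ∀ 𝔓 ∈ v.primesAbove, ∀ σ ∈ 𝔓.inertia (absoluteGaloisGroup ℚ), ∀ P ∈ Φ₀,
            σ • P = (if σ ∈ galRange (K := ℚ) K then P else -P) := by
  have hD0 : D ≠ 0 := hsq.ne_zero
  have hD0' : (D : ℚ) ≠ 0 := by exact_mod_cast hD0
  obtain ⟨Φ, hΦ, hχ⟩ := KernelDisc.exists_isRationalLine_kernelChar_of_cert hψ hD0 hs hDs
  -- a non-zero point of the line
  haveI : Finite Φ := Nat.finite_of_card_ne_zero (by rw [hΦ.1]; decide)
  haveI : Nontrivial Φ := Finite.one_lt_card_iff_nontrivial.mp (by rw [hΦ.1]; decide)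
  obtain ⟨⟨P₀, hP₀⟩, hP₀ne⟩ := exists_ne (0 : Φ)
  have hP₀0 : P₀ ≠ 0 := fun h ↦ hP₀ne (Subtype.ext h)
  refine ⟨Φ, hΦ, KernelDisc.lineEven_of_pos hχ hpos, ?_, ?_⟩
  · -- non-trivial action: the Kummer element at the odd prime `q ∣ D` negates `√D`
    obtain ⟨v, hv⟩ :=
      Literature.NumberTheory.NumberFields.RingOfIntegers.exists_heightOneSpectrum_natCast_mem ℚ hq.out
    obtain ⟨𝔓, h𝔓⟩ := HeightOneSpectrum.primesAbove_nonempty v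
    have hval := KernelDisc.intValuation_intCast_eq_exp_neg_one_of_squarefree (p := q) hsq hqD hv
    have h2 : (2 : 𝓞 ℚ) ∉ v.asIdeal := two_not_mem_of_natCast_prime_mem hq.out hq2 hv
    obtain ⟨σ, -, hneg⟩ := exists_mem_inertia_smul_geomSqrt_eq_neg hval h2 h𝔓
    have hcast : ((D : 𝓞 ℚ) : ℚ) = (D : ℚ) := by simp
    rw [hcast] at hneg
    refine ⟨σ, P₀, hP₀, fun hfix ↦ ?_⟩
    have hall : ∀ Q ∈ Φ, σ • Q = Q := (KernelDisc.forall_smul_eq_iff_of_mem hΦ hP₀ hP₀0 σ).mpr hfix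
    have h := (hχ σ).mp hall
    rw [h] at hneg
    exact geomSqrt_ne_neg hD0' hneg
  · -- the `χ_K`-twist is ramified at `3`: an inertia element at `3` fixes `Φ` but negates `√−3`
    intro K _ _ _ h2K hθ hall
    obtain ⟨θ, hθ⟩ := hθ
    obtain ⟨v, hv⟩ :=
      Literature.NumberTheory.NumberFields.RingOfIntegers.exists_heightOneSpectrum_natCast_mem ℚ hp.out
    obtain ⟨σ, hσI, hσneg⟩ := exists_mem_absInertia_smul_geomSqrt_pStar_eq_neg 3 (by decide) hv
    set τ : absoluteGaloisGroup ℚ := absGaloisRestrict ℚ (v.adicCompletion ℚ) σ with hτ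
    have hτI : τ ∈ (adicCompletionPrime ℚ v).inertia (absoluteGaloisGroup ℚ) := by
      rw [inertia_adicCompletionPrime_eq_map_absInertia]
      exact Subgroup.mem_map.2 ⟨σ, hσI, rfl⟩
    -- `τ` fixes `√D` (`3 ∤ 4D`), hence `Φ` pointwise
    have hfixD : τ • geomSqrt ((D : ℤ) : ℚ) = geomSqrt ((D : ℤ) : ℚ) :=
      smul_geomSqrt_eq_of_mem_inertia (p := 3) (not_dvd_four_mul (by decide) h3D) hv
        (adicCompletionPrime_mem_primesAbove ℚ v) hτI
    have hfixΦ : τ • P₀ = P₀ := (hχ τ).mpr hfixD P₀ hP₀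
    -- `τ ∉ galRange K`: it negates `j(θ) = ±√−3`
    have hsqθ := embIntoClosure_sq K hθ
    have hsqr := geomSqrt_sq ((-1 : ℚ) ^ ((3 : ℕ) / 2) * (3 : ℕ))
    have hpm : embIntoClosure (K := ℚ) K θ = geomSqrt ((-1 : ℚ) ^ ((3 : ℕ) / 2) * (3 : ℕ)) ∨
        embIntoClosure (K := ℚ) K θ = -geomSqrt ((-1 : ℚ) ^ ((3 : ℕ) / 2) * (3 : ℕ)) := by
      exact sq_eq_sq_iff_eq_or_eq_neg.mp (hsqθ.trans hsqr.symm)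
    have hr0 : geomSqrt ((-1 : ℚ) ^ ((3 : ℕ) / 2) * (3 : ℕ)) ≠
        -geomSqrt ((-1 : ℚ) ^ ((3 : ℕ) / 2) * (3 : ℕ)) := geomSqrt_ne_neg (by norm_num)
    have hτK : τ ∉ galRange (K := ℚ) K := by
      apply not_mem_galRange_of_smul_embIntoClosure_ne K
      rcases hpm with h | h
      · rw [h, hσneg]
        exact fun e ↦ hr0 e.symm
      · rw [h, smul_neg, hσneg, neg_neg]
        exact hr0
    -- contradiction: `τ • P₀ = -P₀` by `hall`, but `τ` fixes `P₀ ≠ 0`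
    have hτP := hall v hv (adicCompletionPrime ℚ v) (adicCompletionPrime_mem_primesAbove ℚ v) τ hτI
      P₀ hP₀
    rw [if_neg hτK, hfixΦ] at hτP
    -- `P₀ = -P₀` with `3 • P₀ = 0` forces `P₀ = 0`
    apply hP₀0
    refine X2.ResidualDevissageLine.eq_zero_of_two_nsmul_eq_zero (by decide) P₀
      (X2.ResidualDevissageLine.nsmul_eq_zero_of_mem_geomTorsion P₀) ?_
    rw [two_nsmul]
    nth_rewrite 2 [hτP]
    exact add_neg_cancel P₀

end Summit.BirchSwinnertonDyer.Rank1Residual.Additive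

end
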